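import Literature.MathematicalPhysics.QuantumFieldTheory.Balaban1983to89.B8Prop6Reg335ZdDomainSeq
import Literature.MathematicalPhysics.QuantumFieldTheory.Balaban1983to89.Node00.CarriersB8SubDKappa

/-!
# `Balaban1983to89.B8Prop6Reg335ZdKappa` — [Balaban1985RegularSpaces] PROPOSITION 6's PRINTED APPLICATION («hence … we have proved the regularity
# condition (3.35)») WITH THE BLOCK-SIZE FLOOR NAMED (`M ≥ 11d + 1`), AND ITS READING AT THE PRINT-CLASS CUTS OF RECORD `IdxB8SubDκ θ M₁ R`,
# `IdxB8SubDPerκ θ P M₁ R` — in particular AT THE PINNED BLOCK SIZE `M := M₁` under the decidable guard `11·θ.D + 1 ≤ M₁`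

statement-level skeleton of published theorems with citation tags; proofs where landed; nothing here is a claim about the
Yang–Mills mass gap

PDF held: `paper:balaban1985-cmp99-regular-spaces-gauge-fixing` p. 77 (p0003: (1.3)–(1.4) «Ω_j is a sum of cubes of a size M₁Lʲη, (Lʲη)⁻¹dist(Ω_jᶜ, Ω_{j+1})
> RM₁», «M₁ … is fixed in [4]»), p. 98–99 (p0024–p0025: Proposition 6; «hence … we have proved the regularity condition (3.35). This implies that we can
drop out this condition from the assumption (1.33)»); [4] = [Balaban1985BackgroundPropagators] p. 396 ((3.35) on the cube class), p. 399 («M and R sufficiently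
large»).  Read on the held text layer by this seat (2026-08-28).

WHY THIS FILE (cell `pub-ymgap`, YM-PLAN Track A node N05, FAN-OUT §N05 row s3b; seat `pub-ymgap-dag-n05-e` (g22); count-neutral).  Director-ym №220∕№221
(SECOND-GAP SG-1 «N05 CLASS»: Q-SG1 = «SURVIVES» ⇒ a CUT of the N05 family index to print's literal (1.3)–(1.4) class is necessary) put the N05 slot of record on the
(β′-PERIODIC) road over dag-n05-w1's cut index `Node00.IdxB8SubDPerκ θ P M₁ R` (`CarriersB8SubDKappa`, p642618) with the BLOCK SIZE PINNED at print's `M₁`: the cut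
member is served in NODE N06's separation currency `Sep22Zd R (memZd M j m)` only for `⌈M⌉₊ ≤ M₁` (`IdxB8SubDPerκ.sep22Zd`), while every junction binder of the
J-N06→N05 knit quantifies `∀ M ≥ M₃` — so dag-n05-d's P4 κ-knit reads the binders AT `M := M₁` under the displayed guard `1 ≤ M₁ ∧ M₃ ≤ M₁`, and the closer
instance pins `(M₁, R)` at print's pair OUTSIDE the existential of the κ-slot (plan g86 `D86-SG1/README.md` §(b)).  For the [B8]-Prop-6 binder `Prop6At` of that
knit this lineage's unconditional suppliers (`B8Prop6Reg335ZdDomainSeq` §4 `prop6At_bgZd_domainSeq_holds` ∕ `prop6At_binder_domainSeq_holds`, p620522;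
`B8Prop6Reg335ZdLawMember` §4, p613858) HIDE the floor behind `∃ M₃ > 0` — adequate on the ℤᵈ road, where the knit CHOOSES `M`, but NOT at a pinned `M₁`: a consumer
cannot prove `M₃ ≤ M₁` for an opaque `M₃`.  The floor is in fact the explicit numeral `11d + 1` of the conditional §3 `prop6At_bgZd_of_prop6Printed` (p620522 :187).
This file NAMES it (§1) and reads the binder at the two κ indices of record (§2), in particular at `M := M₁` under the DECIDABLE ℕ-guard `11·θ.D + 1 ≤ M₁` — the
shape the κ-knit and the κ-closer instance can discharge by `norm_num` once `M₁` is a numeral (`45 ≤ M₁` at `d = 4`).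

WHAT IS PROVED (kernel-checked; 0 sorry; 0 def; `𝔸 : Type` a nontrivial C⋆-algebra in §1, the record's `θ.𝔸` in §2).
* §1 ★★ `prop6At_bgZd_domainSeq_holds_explicit` — `d ≥ 2`, `L ≥ 5` odd ⊢ `∃ c35 c₆ K₆ > 0, ∀ M i m, DomainSeq L i.Ω → 11d + 1 ≤ M → Prop6At (bgZd 𝔸 L) L memZd
  (ιCfgZd 𝔸 L) c35 c₆ K₆ M i m` (= p620522 §4 with `M₃` NAMED; proof: p620522 §3 at F1 `prop6Printed_zdCubP_γ_holds`'s constants, `s := 4ρ₀L`); the side-law binder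
  shape `prop6At_binder_domainSeq_holds_explicit`; and the CLASS-CONSTANT-MONOTONE packaging `prop6At_binder_domainSeq_holds_explicit_mono` (`∀ c35 ≥ c35₀`, the shape
  dag-n05-d's `…WithQQPP6(Guarded)` knits consume, via `prop6At_bgZd_mono`).
* §2 AT THE κ INDICES OF RECORD (`θ : Stage3Params`, `2 ≤ θ.D`, `5 ≤ θ.L`, `Odd θ.L` from `θ.hL.1`; the constants are chosen BEFORE `(P, M₁, R)` — uniform over the pin):
  ★ `prop6At_bgZd_idxB8SubDκ_holds` ∕ ★ `prop6At_bgZd_idxB8SubDPerκ_holds` (every `M ≥ 11·θ.D + 1`, member `j.toZdIdx`, laws `j.domainSeq`);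
  ★★ `prop6At_bgZd_idxB8SubDκ_pinned` ∕ ★★ `prop6At_bgZd_idxB8SubDPerκ_pinned` (AT `M := M₁`, guard `11·θ.D + 1 ≤ M₁` in ℕ);
  ★★★ `prop6At_binder_idxB8SubDPerκ_pinned_mono` — the junction-binder shape of the P4 κ-knit: `∃ c35₀ c₆ K₆ > 0, ∀ c35 ≥ c35₀, ∀ {P M₁ R}, 11·θ.D + 1 ≤ M₁ →
  ∀ (j : IdxB8SubDPerκ θ P M₁ R) (m), m ≤ j.toZdIdx.k → Prop6At (bgZd θ.𝔸 θ.L) θ.L memZd (ιCfgZd θ.𝔸 θ.L) c35 c₆ K₆ M₁ j.toZdIdx m` (+ the `IdxB8SubDκ` twin).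
HONEST SCOPE.  (a) The floor `11d + 1` is the one p620522 §3's inscription argument needs (`exists_printCube_over_classCube_of_sep`); NOT claimed optimal; print fixes
`M₁` «in [4]» without a numeral.  (b) `R`, `P` and the (1.4) separation are NOT read by Proposition 6 — the κ instances only use the (1.3)∕(1.5) laws `DomainSeq` of the
member (`IdxB8SubDκ.domainSeq`, `IdxB8SubDPerκ.domainSeq`); the cut matters for the OTHER junction binders (N06).  (c) NOTHING of [4] touched; (3.36) not produced;
Proposition 6 CONSUMED by name (F1 `B8Prop6PrintedZdCubPGamma.prop6Printed_zdCubP_γ_holds`, p596570).  (d) p620522 ∕ p613858 ∕ p611683 stand unchanged (landed files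
are immutable; this is a sibling module).  (e) Whether the κ-closer pins `(M₁, R)` at numerals (then EVERY junction floor — N06's included — must be explicit, this file
being the Prop-6 share) or binds them existentially (then p620522 §4 already serves) is plan g86's ∕ the n24 lanes' choice; either way the statements below are true
and consumer-ready.  Count-neutral; N05 ∕ N06 NOT discharged; FLAG №10 not closed by this file; one finite lattice programme at fixed spacing, Bałaban AS PRINTED;
nothing continuum ∕ ℝ⁴ ∕ OS ∕ mass-gap ∕ Clay.  No `sorry`, no `axiom`, no definition, no `instance`, no `notation`.
Unit `pub-ymgap-dag-n05-e` (g22), 2026-08-28.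
-/

noncomputable section

namespace Literature.MathematicalPhysics.QuantumFieldTheory.Balaban1983to89.B8Prop6Reg335ZdKappa

open B8LeafModelZd (ZdIdx)
open B8ConstraintBonds (DomainSeq)
open B9SupplySockB9P3ZdAt (Prop6At)
open B9SupplySockB9P3ZdFrame (memZd bgZd ιCfgZd)
open B8Prop6Reg335ZdAllTorus (prop6At_bgZd_mono)
open B8Prop6Reg335ZdDomainSeq (prop6At_bgZd_of_prop6Printed)
open B8Prop6PrintedZdCubPGamma (prop6Printed_zdCubP_γ_holds)
open Node00 (Stage3Params IdxB8SubDκ IdxB8SubDPerκ)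

variable {d : ℕ}

/-! ## §1 The floor named: `M ≥ 11d + 1` -/

section Explicit

variable {𝔸 : Type} [CStarAlgebra 𝔸] [Nontrivial 𝔸]

/-- ★★ **[B8] PROPOSITION 6's PRINTED APPLICATION AT EVERY (1.3)–(1.4) MEMBER, UNCONDITIONAL, FLOOR NAMED** (`d ≥ 2`, `L ≥ 5` odd, any nontrivial C⋆-algebra `𝔸`,
ANY `Ω₀`): `∃ c35 c₆ K₆ > 0` such that for every `i : ZdIdx d L` with `DomainSeq L i.Ω`, EVERY `M ≥ 11d + 1` and every `m`, dag-n06-b's junction binder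
`Prop6At (bgZd 𝔸 L) L memZd (ιCfgZd 𝔸 L) c35 c₆ K₆ M i m` — «U₀ ∈ 𝔄_m({Ω_j}, α₀), Mα₀ ≤ c₆ ⇒ U₀ satisfies (3.35) of [4] on the p. 396 cube class with
O(1)Mα₀ = c35·M·K₆α₀» — HOLDS.  Same proof as `B8Prop6Reg335ZdDomainSeq.prop6At_bgZd_domainSeq_holds` (§3 there with `s := 4ρ₀L` at the constants of
`B8Prop6PrintedZdCubPGamma.prop6Printed_zdCubP_γ_holds`), the threshold `M₃ = 11d + 1` kept in the statement instead of behind an `∃`.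
[cite: Balaban1985RegularSpaces, Prop. 6 (1.135)–(1.138) p.99, (1.33) p.82, (1.3)–(1.4) p.77, p.98; Balaban1985BackgroundPropagators, (3.35) p.396] -/
theorem prop6At_bgZd_domainSeq_holds_explicit (hd2 : 2 ≤ d) {L : ℕ} (hL5 : 5 ≤ L) (hodd : Odd L) :
    ∃ c35 c₆ K₆ : ℝ, 0 < c35 ∧ 0 < c₆ ∧ 0 < K₆ ∧
      ∀ (M : ℝ) (i : ZdIdx d L) (m : ℕ), DomainSeq L i.Ω → (11 * d + 1 : ℝ) ≤ M →
        Prop6At (bgZd 𝔸 L) L memZd (ιCfgZd 𝔸 L) c35 c₆ K₆ M i m := by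
  obtain ⟨ρ₀, B₀, c₁, hρ₀, hB₀, hc₁, H⟩ := prop6Printed_zdCubP_γ_holds (𝔸 := 𝔸) hd2 hL5 hodd
  have hL : 2 ≤ L := le_trans (by norm_num) hL5
  have hd0 : (0 : ℝ) < d := by exact_mod_cast (lt_of_lt_of_le zero_lt_two hd2)
  have hL0 : (0 : ℝ) < L := by exact_mod_cast (lt_of_lt_of_le zero_lt_two hL)
  have hρ0 : (0 : ℝ) < ρ₀ := by exact_mod_cast (lt_of_lt_of_le zero_lt_one hρ₀)
  have hB0 : (0 : ℝ) ≤ B₀ := le_trans zero_le_one hB₀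
  have hB₁ : 0 ≤ 5 * (d : ℝ) * L * B₀ := by positivity
  have hs : 4 * ρ₀ * L ≤ L ^ (4 * ρ₀ * L) := (Nat.lt_pow_self (by omega : 1 < L)).le
  refine ⟨(7 * d * (L : ℝ) ^ 2 * (5 * (d : ℝ) * L * B₀) * (20 * (L : ℝ) ^ (4 * ρ₀ * L) + 2 * ρ₀) + 84 * d * (L : ℝ) ^ (4 * ρ₀ * L) + 1)
      * ((L : ℝ) ^ (4 * ρ₀ * L)) ^ 2,
    min (1 / (42 * d * (L : ℝ) ^ (4 * ρ₀ * L))) (c₁ / (7 * d * (L : ℝ) ^ 2 * (20 * (L : ℝ) ^ (4 * ρ₀ * L) + 2 * ρ₀))), 1,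
    by positivity, lt_min (by positivity) (by positivity), one_pos, fun M i m hDS hM => ?_⟩
  exact prop6At_bgZd_of_prop6Printed hd2 hL hρ₀ hs hB₁ hc₁ (fun f => H f) hM i hDS m

/-- **THE BINDER SHAPE OVER A LAW CLASS, FLOOR NAMED** (any side law `P` on the datum — NODE 00's `IdxB8LawsB θ.L`, a knit's member predicate —; the domain laws as
`DomainSeq L i.Ω`): `d ≥ 2`, `L ≥ 5` odd ⊢ `∃ c35 c₆ K₆ > 0, ∀ M i m, P i → DomainSeq L i.Ω → 11d + 1 ≤ M → Prop6At (bgZd 𝔸 L) … c35 c₆ K₆ M i m`.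
[cite: Balaban1985RegularSpaces, Prop. 6 p.99, (1.33) p.82, (1.3)–(1.4) p.77; Balaban1985BackgroundPropagators, (3.35) p.396, Thm 3.3 p.399] -/
theorem prop6At_binder_domainSeq_holds_explicit (hd2 : 2 ≤ d) {L : ℕ} (hL5 : 5 ≤ L) (hodd : Odd L) (P : ZdIdx d L → Prop) :
    ∃ c35 c₆ K₆ : ℝ, 0 < c35 ∧ 0 < c₆ ∧ 0 < K₆ ∧
      ∀ (M : ℝ) (i : ZdIdx d L) (m : ℕ), P i → DomainSeq L i.Ω → (11 * d + 1 : ℝ) ≤ M →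
        Prop6At (bgZd 𝔸 L) L memZd (ιCfgZd 𝔸 L) c35 c₆ K₆ M i m := by
  obtain ⟨c35, c₆, K₆, h35, h₆, hK, H⟩ := prop6At_bgZd_domainSeq_holds_explicit (𝔸 := 𝔸) hd2 hL5 hodd
  exact ⟨c35, c₆, K₆, h35, h₆, hK, fun M i m _ hDS hM => H M i m hDS hM⟩

/-- **THE BINDER SHAPE, FLOOR NAMED, CLASS CONSTANT MONOTONE** (the packaging dag-n05-d's junction knits consume: the leaf's class constant `c35` is any number
`≥ c35₀`, cf. `B8Prop6Reg335ZdAllTorus.prop6At_bgZd_mono`): `d ≥ 2`, `L ≥ 5` odd ⊢ `∃ c35₀ c₆ K₆ > 0, ∀ c35 ≥ c35₀, ∀ M i m, P i → DomainSeq L i.Ω → 11d + 1 ≤ M →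
Prop6At (bgZd 𝔸 L) … c35 c₆ K₆ M i m`. [cite: Balaban1985RegularSpaces, Prop. 6 p.99, (1.3)–(1.4) p.77; Balaban1985BackgroundPropagators, (3.35) p.396, Thm 3.3 p.399] -/
theorem prop6At_binder_domainSeq_holds_explicit_mono (hd2 : 2 ≤ d) {L : ℕ} (hL5 : 5 ≤ L) (hodd : Odd L) (P : ZdIdx d L → Prop) :
    ∃ c35₀ c₆ K₆ : ℝ, 0 < c35₀ ∧ 0 < c₆ ∧ 0 < K₆ ∧
      ∀ ⦃c35 : ℝ⦄, c35₀ ≤ c35 → ∀ (M : ℝ) (i : ZdIdx d L) (m : ℕ), P i → DomainSeq L i.Ω → (11 * d + 1 : ℝ) ≤ M →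
        Prop6At (bgZd 𝔸 L) L memZd (ιCfgZd 𝔸 L) c35 c₆ K₆ M i m := by
  obtain ⟨c35₀, c₆, K₆, h35, h₆, hK, H⟩ := prop6At_binder_domainSeq_holds_explicit (𝔸 := 𝔸) hd2 hL5 hodd P
  have hL1 : 1 ≤ L := le_trans (by norm_num) hL5
  have hd0 : (0 : ℝ) ≤ d := Nat.cast_nonneg d
  refine ⟨c35₀, c₆, K₆, h35, h₆, hK, fun c35 hc35 M i m hP hDS hM => ?_⟩
  exact prop6At_bgZd_mono hL1 hc35 (by linarith) hK.le (H M i m hP hDS hM)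

end Explicit

/-! ## §2 The binder at the print-class cuts of record, block size pinned -/

section Kappa

variable (θ : Stage3Params)

/-- ★ **[B8] PROPOSITION 6's (3.35) AT EVERY MEMBER OF THE PRINT-CLASS CUT `IdxB8SubDκ θ M₁ R`** (the ℤᵈ P₂D road's index cut to (1.3)–(1.4), dag-n05-w1
`CarriersB8SubDKappa`): `2 ≤ θ.D`, `5 ≤ θ.L` (odd by `θ.hL`) ⊢ `∃ c35 c₆ K₆ > 0`, chosen BEFORE `(M₁, R)`, with `Prop6At (bgZd θ.𝔸 θ.L) θ.L memZd (ιCfgZd θ.𝔸 θ.L) c35 c₆ K₆ M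
j.toZdIdx m` for every `M ≥ 11·θ.D + 1`, every cut member `j` and every truncation `m` — §1 at `j.toZdIdx` with the member's (1.3)∕(1.5) laws `j.domainSeq`; the (1.4)
separation `R` is not read by Proposition 6. [cite: Balaban1985RegularSpaces, Prop. 6 p.99, (1.3)–(1.4) p.77; Balaban1985BackgroundPropagators, (3.35) p.396] -/
theorem prop6At_bgZd_idxB8SubDκ_holds (hD : 2 ≤ θ.D) (hL5 : 5 ≤ θ.L) :
    ∃ c35 c₆ K₆ : ℝ, 0 < c35 ∧ 0 < c₆ ∧ 0 < K₆ ∧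
      ∀ {M₁ R : ℕ} (M : ℝ) (j : IdxB8SubDκ θ M₁ R) (m : ℕ), (11 * θ.D + 1 : ℝ) ≤ M →
        Prop6At (bgZd θ.𝔸 θ.L) θ.L memZd (ιCfgZd θ.𝔸 θ.L) c35 c₆ K₆ M j.toZdIdx m := by
  obtain ⟨c35, c₆, K₆, h35, h₆, hK, H⟩ := prop6At_bgZd_domainSeq_holds_explicit (𝔸 := θ.𝔸) hD hL5 θ.hL.1
  exact ⟨c35, c₆, K₆, h35, h₆, hK, fun M j m hM => H M j.toZdIdx m j.domainSeq hM⟩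

/-- ★★ **THE SAME READ AT THE PINNED BLOCK SIZE `M := M₁`** (dag-n05-d's P4 reading «binders at the ONE pinned block size»): the floor becomes the DECIDABLE
ℕ-guard `11·θ.D + 1 ≤ M₁` on the pin (`45 ≤ M₁` at `θ.D = 4`). [cite: Balaban1985RegularSpaces, Prop. 6 p.99, (1.3)–(1.4) p.77 («M₁ … fixed in [4]»); Balaban1985BackgroundPropagators, (3.35) p.396] -/
theorem prop6At_bgZd_idxB8SubDκ_pinned (hD : 2 ≤ θ.D) (hL5 : 5 ≤ θ.L) :
    ∃ c35 c₆ K₆ : ℝ, 0 < c35 ∧ 0 < c₆ ∧ 0 < K₆ ∧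
      ∀ {M₁ R : ℕ}, 11 * θ.D + 1 ≤ M₁ → ∀ (j : IdxB8SubDκ θ M₁ R) (m : ℕ),
        Prop6At (bgZd θ.𝔸 θ.L) θ.L memZd (ιCfgZd θ.𝔸 θ.L) c35 c₆ K₆ (M₁ : ℝ) j.toZdIdx m := by
  obtain ⟨c35, c₆, K₆, h35, h₆, hK, H⟩ := prop6At_bgZd_idxB8SubDκ_holds θ hD hL5
  exact ⟨c35, c₆, K₆, h35, h₆, hK, fun hM₁ j m => H _ j m (by exact_mod_cast hM₁)⟩

/-- ★ **[B8] PROPOSITION 6's (3.35) AT EVERY MEMBER OF THE PERIODIC PRINT-CLASS CUT `IdxB8SubDPerκ θ P M₁ R`** (director-ym №220 (A-4)'s index, the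
(β′-PERIODIC) road; any period `P`): `∃ c35 c₆ K₆ > 0`, chosen BEFORE `(P, M₁, R)`, with the binder at `j.toZdIdx` for every `M ≥ 11·θ.D + 1`, every `j`, every `m`
— §1 with `j.domainSeq`; periodicity and `R` are not read by Proposition 6 (periodic data stay on the `ℤᵈ` carrier: the frame is `bgZd`).
[cite: Balaban1985RegularSpaces, Prop. 6 p.99, (1.3)–(1.4) p.77, p.77 («Ω_j ⊂ T_η»); Balaban1985BackgroundPropagators, (3.35) p.396] -/
theorem prop6At_bgZd_idxB8SubDPerκ_holds (hD : 2 ≤ θ.D) (hL5 : 5 ≤ θ.L) :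
    ∃ c35 c₆ K₆ : ℝ, 0 < c35 ∧ 0 < c₆ ∧ 0 < K₆ ∧
      ∀ {P M₁ R : ℕ} (M : ℝ) (j : IdxB8SubDPerκ θ P M₁ R) (m : ℕ), (11 * θ.D + 1 : ℝ) ≤ M →
        Prop6At (bgZd θ.𝔸 θ.L) θ.L memZd (ιCfgZd θ.𝔸 θ.L) c35 c₆ K₆ M j.toZdIdx m := by
  obtain ⟨c35, c₆, K₆, h35, h₆, hK, H⟩ := prop6At_bgZd_domainSeq_holds_explicit (𝔸 := θ.𝔸) hD hL5 θ.hL.1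
  exact ⟨c35, c₆, K₆, h35, h₆, hK, fun M j m hM => H M j.toZdIdx m j.domainSeq hM⟩

/-- ★★ **THE PERIODIC CUT READ AT THE PINNED BLOCK SIZE `M := M₁`**: guard `11·θ.D + 1 ≤ M₁` in ℕ.
[cite: Balaban1985RegularSpaces, Prop. 6 p.99, (1.3)–(1.4) p.77 («M₁ … fixed in [4]»); Balaban1985BackgroundPropagators, (3.35) p.396] -/
theorem prop6At_bgZd_idxB8SubDPerκ_pinned (hD : 2 ≤ θ.D) (hL5 : 5 ≤ θ.L) :
    ∃ c35 c₆ K₆ : ℝ, 0 < c35 ∧ 0 < c₆ ∧ 0 < K₆ ∧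
      ∀ {P M₁ R : ℕ}, 11 * θ.D + 1 ≤ M₁ → ∀ (j : IdxB8SubDPerκ θ P M₁ R) (m : ℕ),
        Prop6At (bgZd θ.𝔸 θ.L) θ.L memZd (ιCfgZd θ.𝔸 θ.L) c35 c₆ K₆ (M₁ : ℝ) j.toZdIdx m := by
  obtain ⟨c35, c₆, K₆, h35, h₆, hK, H⟩ := prop6At_bgZd_idxB8SubDPerκ_holds θ hD hL5
  exact ⟨c35, c₆, K₆, h35, h₆, hK, fun hM₁ j m => H _ j m (by exact_mod_cast hM₁)⟩

/-- ★★★ **THE JUNCTION-BINDER SHAPE OF THE P4 κ-KNIT, `hP6` SLOT** (dag-n05-d's reading «`∀ (j : IdxB8SubDPerκ θ P M₁ R) (m), m ≤ j…k → X M₁ j.toZdIdx m`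
under the guard `1 ≤ M₁ ∧ M₃ ≤ M₁`», with the Prop-6 floor `M₃ := 11·θ.D + 1` NAMED and the class constant monotone): `∃ c35₀ c₆ K₆ > 0, ∀ c35 ≥ c35₀, ∀ {P M₁ R},
11·θ.D + 1 ≤ M₁ → ∀ j m, m ≤ j.toZdIdx.k → Prop6At (bgZd θ.𝔸 θ.L) θ.L memZd (ιCfgZd θ.𝔸 θ.L) c35 c₆ K₆ M₁ j.toZdIdx m` (the truncation guard is not needed by
Proposition 6 and is carried only to match the knit's text). [cite: Balaban1985RegularSpaces, Prop. 6 p.99, (1.3)–(1.4) p.77; Balaban1985BackgroundPropagators, (3.35) p.396, Thm 3.3 p.399] -/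
theorem prop6At_binder_idxB8SubDPerκ_pinned_mono (hD : 2 ≤ θ.D) (hL5 : 5 ≤ θ.L) :
    ∃ c35₀ c₆ K₆ : ℝ, 0 < c35₀ ∧ 0 < c₆ ∧ 0 < K₆ ∧
      ∀ ⦃c35 : ℝ⦄, c35₀ ≤ c35 → ∀ {P M₁ R : ℕ}, 11 * θ.D + 1 ≤ M₁ →
        ∀ (j : IdxB8SubDPerκ θ P M₁ R) (m : ℕ), m ≤ j.toZdIdx.k →
          Prop6At (bgZd θ.𝔸 θ.L) θ.L memZd (ιCfgZd θ.𝔸 θ.L) c35 c₆ K₆ (M₁ : ℝ) j.toZdIdx m := by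
  obtain ⟨c35₀, c₆, K₆, h35, h₆, hK, H⟩ :=
    prop6At_binder_domainSeq_holds_explicit_mono (𝔸 := θ.𝔸) hD hL5 θ.hL.1 (fun _ : ZdIdx θ.D θ.L => True)
  refine ⟨c35₀, c₆, K₆, h35, h₆, hK, fun c35 hc35 P M₁ R hM₁ j m _ => ?_⟩
  exact H hc35 (M₁ : ℝ) j.toZdIdx m trivial j.domainSeq (by exact_mod_cast hM₁)

/-- **THE `IdxB8SubDκ` TWIN** of `prop6At_binder_idxB8SubDPerκ_pinned_mono` (the ℤᵈ P₂D road's cut, should its chain be re-keyed to the class).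
[cite: Balaban1985RegularSpaces, Prop. 6 p.99, (1.3)–(1.4) p.77; Balaban1985BackgroundPropagators, (3.35) p.396, Thm 3.3 p.399] -/
theorem prop6At_binder_idxB8SubDκ_pinned_mono (hD : 2 ≤ θ.D) (hL5 : 5 ≤ θ.L) :
    ∃ c35₀ c₆ K₆ : ℝ, 0 < c35₀ ∧ 0 < c₆ ∧ 0 < K₆ ∧
      ∀ ⦃c35 : ℝ⦄, c35₀ ≤ c35 → ∀ {M₁ R : ℕ}, 11 * θ.D + 1 ≤ M₁ →
        ∀ (j : IdxB8SubDκ θ M₁ R) (m : ℕ), m ≤ j.toZdIdx.k →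
          Prop6At (bgZd θ.𝔸 θ.L) θ.L memZd (ιCfgZd θ.𝔸 θ.L) c35 c₆ K₆ (M₁ : ℝ) j.toZdIdx m := by
  obtain ⟨c35₀, c₆, K₆, h35, h₆, hK, H⟩ :=
    prop6At_binder_domainSeq_holds_explicit_mono (𝔸 := θ.𝔸) hD hL5 θ.hL.1 (fun _ : ZdIdx θ.D θ.L => True)
  refine ⟨c35₀, c₆, K₆, h35, h₆, hK, fun c35 hc35 M₁ R hM₁ j m _ => ?_⟩
  exact H hc35 (M₁ : ℝ) j.toZdIdx m trivial j.domainSeq (by exact_mod_cast hM₁)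

end Kappa

end Literature.MathematicalPhysics.QuantumFieldTheory.Balaban1983to89.B8Prop6Reg335ZdKappa

end
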